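import Summits.ResolutionOfSingularities.ResolutionOfSingularities.Theorems.FrobeniusClosingSteerOrderInductionWords
import Summits.ResolutionOfSingularities.ResolutionOfSingularities.Theorems.FrobeniusClosingSteerMemberDualDerivations
import Mathlib.FieldTheory.Perfect
import Mathlib.Algebra.CharP.Subring
import Mathlib.Algebra.CharP.Lemmas
import HarnessLib

/-!
# Crux `Steer` (stmt-ResolutionOfSingularities-16345), chain W4.1 — **(DR-1) a core datum REACHES CLEANED ORDER 2**
# (`cleanerReaches_two_of_coreDatum`, the load-bearing stub of res-L0-w41-strat-1's Dropᴵ∨ kernel, RULING 201(c))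

OURS (campaign `res-hironaka`, rung L, slot W4.1; replaces the role of no printed item; NOT a statement of the manuscript under review
[claim: Hironaka2017, status: under-review]; AI review is weaker than expert review).  Theses-free, definition-free, sorry-free.

**Statement** (signature verbatim from res-L0-w41-tri-1 `v624/RDR_DropRepair_v13.lean` l.348 / res-L0-w41-strat-1 Drop v13 0bfec34daf39afc5):
`CoreDatum p 4 k K O A₀ h₀ t → OrderInduction.CleanerReaches p O A₀.toSubring t 2` — at the root member `R 0 = (A₀)_{𝔪_O ∩ A₀}` the
radicand `t ^ p` can be cleaned to order `≥ 2`: `t ^ p − g ^ p ∈ 𝔪²` for some `g ∈ R 0`.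

**Proof** (assembly of tree theorems; the docstring route of the stub).  The characteristic is a prime (`p = 0` contradicts the
non-`p`-th-power clause).  (1) The residue field of `R 0` is algebraic over the perfect `k` (`ZeroDim`), hence perfect: `t ^ p ≡ g ^ p (mod 𝔪)`
for some `g` (general-`p` copy of `LowMult.exists_sub_sq_mem_maximalIdeal`).  (2) `R 0` is regular of dimension `4` with a regular system of
parameters `y` carrying DUAL `ℤ`-derivations `D a` (`MemberDualDerivations.hasDualDerivations_member`, member `N = 0`).  (3) CoreDatum's derivation
clause, transported along `locAtCentreEquiv : (A₀)_𝔭 ≃ R 0`, gives `D a (t ^ p) ∈ 𝔪`, and `D a (g ^ p) = 0` in characteristic `p`, so every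
`D a (t ^ p − g ^ p)` lies in `𝔪 = (y)`.  (4) Conormal detection: `u = Σ c_b y_b` with `D a u ≡ c_a (mod 𝔪)` forces `c_a ∈ 𝔪`, i.e. `u ∈ 𝔪²`.
[cite: Matsumura1987, Thms. 25.2, 30.6 (dual bases of derivations at a regular point)] [folklore]
-/

noncomputable section

-- `Summit.<S>.<S>.…` duplicates the summit name by design (single-problem summit).
set_option linter.dupNamespace false
set_option autoImplicit false

namespace Summit.ResolutionOfSingularities.ResolutionOfSingularities.Theorems.SwitchingDichotomy.OrderInductionDR1

open IsLocalRing
open Literature.AlgebraicGeometry.Resolution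
open Summit.ResolutionOfSingularities.ResolutionOfSingularities.Theorems.SwitchingDichotomy.Words

variable {K : Type} [Field K]

/-! ### (1) Residues are `p`-th powers (perfect residue field) -/

/-- **Every element of a local subring `S ⊆ O` dominated by `O` is a `p`-th power modulo `𝔪_S`**, when `S` contains (the image of) a
perfect field `k` of characteristic `p` over which the residue field of `O` is algebraic (`ZeroDim`): the residue field of `S` is then
algebraic over `k`, hence perfect.  General-`p` copy of `LowMult.exists_sub_sq_mem_maximalIdeal`. [folklore] -/
theorem exists_sub_pow_mem_maximalIdeal (p : ℕ) [Fact p.Prime] {k : Type} [Field k] [CharP k p] [PerfectField k]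
    [Algebra k K] (O : ValuationSubring K)
    (hzd : ∀ x ∈ O, ∃ f : Polynomial k, f ≠ 0 ∧ Polynomial.aeval x f ∈ O.nonunits)
    (S : Subring K) [IsLocalRing S] (hSO : S ≤ O.toSubring)
    (hdom : ∀ a : S, a ∈ maximalIdeal S ↔ O.valuation (a : K) < 1)
    (hk : ∀ c : k, algebraMap k K c ∈ S) (f : S) : ∃ g : S, f - g ^ p ∈ maximalIdeal S := by
  have hp : p.Prime := Fact.out
  haveI : CharP K p := charP_of_injective_algebraMap (algebraMap k K).injective p
  -- `S` and its residue field as `k`-algebras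
  let φk : k →+* S := (algebraMap k K).codRestrict S hk
  letI : Algebra k S := φk.toAlgebra
  letI : Algebra k (ResidueField S) := ((residue S).comp φk).toAlgebra
  let resAlg : S →ₐ[k] ResidueField S := { residue S with commutes' := fun _ => rfl }
  let incl : S →ₐ[k] K := { S.subtype with commutes' := fun _ => rfl }
  -- the residue field is algebraic over `k`
  haveI : Algebra.IsAlgebraic k (ResidueField S) := by
    refine ⟨fun r => ?_⟩
    obtain ⟨a, rfl⟩ := residue_surjective r
    obtain ⟨P, hP0, hPa⟩ := hzd (a : K) (hSO a.2)
    refine ⟨P, hP0, ?_⟩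
    have h1 : Polynomial.aeval (residue S a) P = residue S (Polynomial.aeval a P) :=
      Polynomial.aeval_algHom_apply resAlg a P
    have h2 : ((Polynomial.aeval a P : S) : K) = Polynomial.aeval (a : K) P :=
      (Polynomial.aeval_algHom_apply incl a P).symm
    rw [h1, residue_eq_zero_iff, hdom, h2]
    exact (ValuationSubring.mem_nonunits_iff O).mp hPa
  haveI : PerfectField (ResidueField S) := Algebra.IsAlgebraic.perfectField k
  haveI : CharP (ResidueField S) p :=
    (CharP.charP_iff_prime_eq_zero hp).mpr (by rw [← map_natCast (residue S) p, CharP.cast_eq_zero, map_zero])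
  haveI : ExpChar (ResidueField S) p := ExpChar.prime hp
  obtain ⟨gbar, hgbar⟩ := (bijective_frobenius (ResidueField S) p).2 (residue S f)
  obtain ⟨g, rfl⟩ := residue_surjective gbar
  refine ⟨g, ?_⟩
  rw [← residue_eq_zero_iff, map_sub, map_pow, ← hgbar, frobenius_def, sub_self]

/-! ### (4) Conormal detection -/

/-- **Conormal detection** in a local ring with a dual system: if `y : Fin 4 → R` generates `𝔪_R`, the derivations `D a` are dual to `y`,
`u ∈ 𝔪_R` and every `D a u ∈ 𝔪_R`, then `u ∈ 𝔪_R ^ 2` (write `u = Σ c_b y_b`; `D a u ≡ c_a (mod 𝔪)`). [folklore] -/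
theorem mem_sq_of_forall_derivation_mem {R : Type} [CommRing R] [IsLocalRing R] (y : Fin 4 → R)
    (D : Fin 4 → Derivation ℤ R R) (hy : Ideal.span (Set.range y) = maximalIdeal R)
    (hD : ∀ a b, D a (y b) = if a = b then 1 else 0) {u : R} (hu : u ∈ maximalIdeal R)
    (hDu : ∀ a, D a u ∈ maximalIdeal R) : u ∈ maximalIdeal R ^ 2 := by
  classical
  rw [← hy] at hu hDu ⊢
  obtain ⟨c, rfl⟩ := Ideal.mem_span_range_iff_exists_fun.mp hu
  have hci : ∀ i, c i ∈ Ideal.span (Set.range y) := by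
    intro i
    have h1 : D i (∑ j, c j * y j) = (∑ j, D i (c j) * y j) + c i := by
      rw [map_sum]
      have hj : ∀ j, D i (c j * y j) = D i (c j) * y j + (if i = j then c j else 0) := by
        intro j
        rw [Derivation.leibniz, smul_eq_mul, smul_eq_mul, hD]
        split_ifs <;> ring
      simp_rw [hj, Finset.sum_add_distrib, Finset.sum_ite_eq, Finset.mem_univ, if_true]
    have h2 : (∑ j, D i (c j) * y j) ∈ Ideal.span (Set.range y) :=
      Ideal.sum_mem _ fun j _ => Ideal.mul_mem_left _ _ (Ideal.subset_span ⟨j, rfl⟩)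
    have h3 := Ideal.sub_mem _ (hDu i) h2
    rwa [h1, add_sub_cancel_left] at h3
  rw [pow_two]
  exact Ideal.sum_mem _ fun j _ => Ideal.mul_mem_mul (hci j) (Ideal.subset_span ⟨j, rfl⟩)

/-! ### (DR-1) The theorem -/

/-- **(DR-1) A CORE DATUM REACHES CLEANED ORDER 2**: `t ^ p − g ^ p ∈ 𝔪_{R 0} ^ 2` for some `g ∈ R 0 = (A₀)_{𝔪_O ∩ A₀}`.
Signature verbatim from res-L0-w41-strat-1's Drop v13 / res-L0-w41-tri-1's `RDR_DropRepair_v13.lean` (there sorried). OURS. [folklore] -/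
theorem cleanerReaches_two_of_coreDatum {p : ℕ} {k : Type} [Field k] [CharP k p] [PerfectField k] [Algebra k K]
    (O : ValuationSubring K) (A₀ : Subalgebra k K) (h₀ : A₀.toSubring ≤ O.toSubring) (t : K)
    (hcd : CoreDatum p 4 k K O A₀ h₀ t) : OrderInduction.CleanerReaches p O A₀.toSubring t 2 := by
  obtain ⟨hfg, htp, hfr, hreg, -, hzd, -, -, -, -, hδ, hpow, htr, -⟩ := hcd
  -- the characteristic is a prime: `p = 0` contradicts the non-`p`-th-power clause (`t ^ 0 = 1 = 1 ^ 0`)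
  rcases CharP.char_is_prime_or_zero k p with hp | hp0
  swap
  · exfalso
    subst hp0
    refine hpow 1 ?_
    have h1 : (⟨t ^ 0, htp⟩ : A₀.toSubring) = 1 := Subtype.ext (pow_zero t)
    rw [h1, map_one, pow_zero]
  haveI : Fact p.Prime := ⟨hp⟩
  haveI : CharP K p := charP_of_injective_algebraMap (algebraMap k K).injective p
  -- the root member `L₀ = R 0`
  haveI hloc : IsLocalRing (locAtCentre A₀.toSubring O) := isLocalRing_locAtCentre h₀
  have hregL : IsRegularLocalRing (locAtCentre A₀.toSubring O) := (isRegularLocalRing_locAtCentre_iff h₀).mpr hreg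
  -- (2) a regular system of parameters with dual derivations (member `N = 0`)
  obtain ⟨_, y, D, hy, hD⟩ := MemberDualDerivations.hasDualDerivations_member p O A₀ h₀ t hfg htp hfr hzd htr
    (fun _ => locAtCentre A₀.toSubring O) rfl 0 (fun i hi => absurd hi (Nat.not_lt_zero i)) hregL
  -- (1) the residue lift
  have htpL : t ^ p ∈ locAtCentre A₀.toSubring O := le_locAtCentre A₀.toSubring O htp
  have hdom : ∀ a : locAtCentre A₀.toSubring O, a ∈ maximalIdeal (locAtCentre A₀.toSubring O) ↔
      O.valuation (a : K) < 1 := fun a => mem_maximalIdeal_locAtCentre_iff h₀ a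
  have hk : ∀ c : k, algebraMap k K c ∈ locAtCentre A₀.toSubring O :=
    fun c => le_locAtCentre _ O (A₀.algebraMap_mem c)
  obtain ⟨g, hg⟩ := exists_sub_pow_mem_maximalIdeal p O hzd (locAtCentre A₀.toSubring O) (locAtCentre_le h₀) hdom hk
    ⟨t ^ p, htpL⟩
  -- (3) every dual derivation sends `t ^ p` into `𝔪`: CoreDatum's derivation clause transported along `locAtCentreEquiv`
  have hDf : ∀ a, D a ⟨t ^ p, htpL⟩ ∈ maximalIdeal (locAtCentre A₀.toSubring O) := by
    intro a
    -- `e : (A₀)_𝔭 ≃ R 0`, typed over CoreDatum's spelling of the centre prime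
    let e : Localization.AtPrime (Ideal.comap (Subring.inclusion h₀) (IsLocalRing.maximalIdeal O)) ≃ₐ[A₀.toSubring]
        locAtCentre A₀.toSubring O := locAtCentreEquiv (B := A₀.toSubring) (O := O) h₀
    rw [IsLocalRing.mem_maximalIdeal, mem_nonunits_iff]
    intro hu
    -- the derivation `x ↦ e⁻¹ (D a (e x))` of `(A₀)_𝔭`, fed to CoreDatum's derivation clause
    refine hδ
      { toFun := fun x => e.symm (D a (e x))
        map_add' := fun x x' => by simp only [map_add]
        map_smul' := fun c x => by
          simp only [RingHom.id_apply]
          rw [Algebra.smul_def, eq_intCast (algebraMap ℤ (Localization.AtPrime (Ideal.comap (Subring.inclusion h₀)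
            (IsLocalRing.maximalIdeal O)))) c, map_mul, map_intCast, (D a).leibniz, (D a).map_intCast,
            smul_zero, add_zero, smul_eq_mul, map_mul, map_intCast]
          exact (zsmul_eq_mul (e.symm (D a (e x))) c).symm
        map_one_eq_zero' := by
          change e.symm (D a (e 1)) = 0
          rw [map_one, (D a).map_one_eq_zero, map_zero]
        leibniz' := fun x x' => by
          change e.symm (D a (e (x * x'))) = x • e.symm (D a (e x')) + x' • e.symm (D a (e x))
          rw [map_mul, (D a).leibniz, smul_eq_mul, smul_eq_mul, map_add, map_mul, map_mul, e.symm_apply_apply,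
            e.symm_apply_apply, smul_eq_mul, smul_eq_mul] } ?_
    change IsUnit (e.symm (D a (e (algebraMap A₀.toSubring (Localization.AtPrime (Ideal.comap (Subring.inclusion h₀)
      (IsLocalRing.maximalIdeal O))) ⟨t ^ p, htp⟩))))
    rw [e.commutes]
    exact hu.map e.symm
  -- `D a (g ^ p) = 0` in characteristic `p`
  have hDg : ∀ a, D a (g ^ p) = 0 := by
    intro a
    rw [Derivation.leibniz_pow, smul_eq_mul, nsmul_eq_mul, CharP.cast_eq_zero, zero_mul]
  -- (4) conormal detection
  have hDu : ∀ a, D a (⟨t ^ p, htpL⟩ - g ^ p) ∈ maximalIdeal (locAtCentre A₀.toSubring O) := by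
    intro a
    rw [map_sub, hDg, sub_zero]
    exact hDf a
  exact ⟨hloc, htpL, g, mem_sq_of_forall_derivation_mem y D hy hD hg hDu⟩

end Summit.ResolutionOfSingularities.ResolutionOfSingularities.Theorems.SwitchingDichotomy.OrderInductionDR1

end
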